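import Literature.Barriers.Schanuel.EFunctionValuesAtAlgebraicPointsDetBounds
import Mathlib.Analysis.SpecialFunctions.Pow.Real
import Mathlib.LinearAlgebra.Dimension.Constructions
import Mathlib.LinearAlgebra.FiniteDimensional.Lemmas
import Mathlib.RingTheory.Localization.Integral
import Mathlib.LinearAlgebra.Matrix.NonsingularInverse
import HarnessLib

/-!
# Barrier (Schanuel) `EFunctionValuesAtAlgebraicPoints`: the rank bound from small independent forms (Baker Ch. 11 §4 ⇒ Rivoal Thm. 5.20) — proofs only

`Literature/Barriers/Schanuel/EFunctionValuesAtAlgebraicPointsRankStep.lean` — sibling file of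
`EFunctionValuesAtAlgebraicPoints.lean` in the programme to discharge `siegelShidlovskii_algIndep`
(Siegel–Shidlovskii; Rivoal Thm. 5.10 = Baker Thm. 11.1). The tree's reduction
(`…Reduction.lean`) leaves the rank theorem `shidlovskii_rankBound` (Rivoal Thm. 5.20) to prove;
this file is its final, purely arithmetic step, i.e. Baker, *Transcendental Number Theory*,
Ch. 11 §4 (pp. 113–114) run for LINEAR relations: from the output of Lemma 4 — for every `ε > 0`
and `r ≫ 1`, algebraic integers `qᵢⱼ ∈ K` with `det(qᵢⱼ) ≠ 0`, conjugates `≤ (r!)^{1+ε}` and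
`|∑ᵢ qᵢⱼ wᵢ| ≤ (r!)^{−(ν−1)+ε}` — and one non-zero value `w_{i₀}`, the values `w₁, …, w_ν`
span a `K`-space of dimension `ρ ≥ ν/[K:ℚ]`:

* `SiegelShidlovskii.rank_bound_of_small_forms` — `ν ≤ [K:ℚ] · dim_K span_K {wᵢ}`.

The argument: a `K`-basis `u₁, …, u_{ν−ρ}` (made integral) of the relations `∑ cᵢ wᵢ = 0`,
completed by `ρ` of the rows `(q_{·j})` to a non-singular matrix `R`
(`linearIndependent_sum_elim_of_span_top`, through the quotient by the relations); then
`det R · w_{i₀} = ∑ ±(minor) · Λⱼ` (adjugate), `|det R| ≥ (ν! H^{ν−ρ} (r!)^{(1+ε)ρ})^{1−[K:ℚ]}`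
(Liouville, `…DetBounds.lean`) against `|det R · w_{i₀}| ≤ ρ ν! H^{ν−ρ}(r!)^{(1+ε)(ρ−1)−(ν−1)+ε}`;
if `ρ[K:ℚ] < ν` the exponents leave `(r!)^{−1/2}`, absurd for `r` large.

All [folklore]; no named facts.

## References

* A. Baker, *Transcendental Number Theory*, CUP 1975, Ch. 11 §4 (pp. 113–114).
* [Rivoal2024] T. Rivoal, *Les E-fonctions et G-fonctions de Siegel* (2024), Théorème 5.20
  ("Voir [157, p. 115, Lem. 17]" = Shidlovskii 1989).
-/

noncomputable section

open Matrix Finset Module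
open scoped Nat

namespace Literature.Barriers.Schanuel

-- The `ℚ`-algebra diamond on subfields of `ℂ` (`DivisionRing.toRatAlgebra` vs
-- `IntermediateField.algebra`): as in `SiegelShidlovskiiRank.lean` and the reduction files of
-- the programme, elaborate with the latter only, so that `finrank ℚ K` below is literally the
-- one of `shidlovskii_rankBound`.
attribute [-instance] DivisionRing.toRatAlgebra

namespace SiegelShidlovskii

/-! ### 1. Linear algebra: completing a basis of the relations by rows of a spanning family -/

section LinAlg

variable {K V : Type*} [Field K] [AddCommGroup V] [Module K V] [FiniteDimensional K V]

/-- **Exchange lemma through the quotient.** Let `u : Fin nu → U` be linearly independent with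
`nu = dim U`, and let `x : Fin ν′ → V` span `V`. Then some `nq = dim V − nu` of the `x`'s complete
the `u`'s to a linearly independent family (hence a basis) of `V`. [folklore] -/
theorem linearIndependent_sum_elim_of_span_top (U : Submodule K V) {nu : ℕ} (u : Fin nu → V)
    (huU : ∀ k, u k ∈ U) (hu : LinearIndependent K u) (hcard : nu = finrank K U)
    {ν' : ℕ} (x : Fin ν' → V) (hx : Submodule.span K (Set.range x) = ⊤) :
    ∃ (nq : ℕ) (J : Fin nq → Fin ν'), nu + nq = finrank K V ∧
      LinearIndependent K (Sum.elim u (x ∘ J)) := by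
  classical
  set x' : Fin ν' → V ⧸ U := U.mkQ ∘ x with hx'
  have hx'top : Submodule.span K (Set.range x') = ⊤ := by
    rw [hx', Set.range_comp, Submodule.span_image, hx, Submodule.map_top, Submodule.range_mkQ]
  obtain ⟨κ, a, ha, hspan, hli⟩ := exists_linearIndependent' (K := K) x'
  haveI : Fintype κ := Fintype.ofInjective a ha
  set e := Fintype.equivFin κ with he
  refine ⟨Fintype.card κ, a ∘ e.symm, ?_, ?_⟩
  · -- dimension count
    have h1 : finrank K (Submodule.span K (Set.range (x' ∘ a))) = Fintype.card κ :=
      finrank_span_eq_card hli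
    rw [hspan, hx'top, finrank_top] at h1
    have h2 := U.finrank_quotient_add_finrank
    omega
  · have hli2 : LinearIndependent K (x ∘ (a ∘ e.symm)) := by
      refine LinearIndependent.of_comp U.mkQ ?_
      have : U.mkQ ∘ (x ∘ (a ∘ e.symm)) = (x' ∘ a) ∘ e.symm := rfl
      rw [this]
      exact hli.comp _ e.symm.injective
    refine linearIndependent_sum.mpr ⟨by simpa using hu, by simpa using hli2, ?_⟩
    simp only [Sum.elim_comp_inl, Sum.elim_comp_inr]
    rw [Submodule.disjoint_def]
    intro z hz1 hz2
    -- `z ∈ span u ⊆ U` and `z = ∑ c_y x_{J y}`; project to the quotient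
    have hzU : z ∈ U := (Submodule.span_le.mpr (Set.range_subset_iff.mpr huU)) hz1
    obtain ⟨c, rfl⟩ := (Submodule.mem_span_range_iff_exists_fun K).mp hz2
    have hq : ∑ i, c i • (x' ∘ a) (e.symm i) = 0 := by
      have := (Submodule.Quotient.mk_eq_zero U).mpr hzU
      rw [← Submodule.mkQ_apply, map_sum] at this
      simpa [hx'] using this
    have hli3 : LinearIndependent K ((x' ∘ a) ∘ e.symm) := hli.comp _ e.symm.injective
    have hc : ∀ i, c i = 0 := Fintype.linearIndependent_iff.mp hli3 c hq
    simp [hc]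

end LinAlg

/-! ### 2. Integral multiples -/

/-- Every element of a number field `K ⊂ ℂ` has a positive integer multiple which is an
algebraic integer. [folklore] -/
theorem exists_nat_mul_isIntegral (K : IntermediateField ℚ ℂ) [FiniteDimensional ℚ K] (x : K) :
    ∃ N : ℕ, 0 < N ∧ IsIntegral ℤ ((N : K) * x) := by
  have halg : IsAlgebraic ℤ x :=
    (IsFractionRing.isAlgebraic_iff ℤ ℚ K).mpr (Algebra.IsAlgebraic.isAlgebraic x)
  obtain ⟨D, hD0, hDint⟩ := halg.exists_integral_multiple
  rw [zsmul_eq_mul] at hDint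
  refine ⟨D.natAbs * D.natAbs, Nat.mul_pos (Int.natAbs_pos.mpr hD0) (Int.natAbs_pos.mpr hD0), ?_⟩
  have hD : ((D.natAbs * D.natAbs : ℕ) : K) = (D : K) * (D : K) := by
    have h1 : ((D.natAbs * D.natAbs : ℕ) : ℤ) = D * D := Int.natAbs_mul_self
    have h2 : ((D.natAbs * D.natAbs : ℕ) : K) = (((D.natAbs * D.natAbs : ℕ) : ℤ) : K) :=
      (Int.cast_natCast _).symm
    rw [h2, h1, Int.cast_mul]
  rw [hD, mul_assoc]
  have hDK : IsIntegral ℤ (D : K) := by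
    simpa using (isIntegral_algebraMap (R := ℤ) (A := K) (x := D))
  exact hDK.mul hDint

/-- Simultaneous version for a finite family. [folklore] -/
theorem exists_nat_mul_isIntegral_family (K : IntermediateField ℚ ℂ) [FiniteDimensional ℚ K]
    {ι : Type*} [Fintype ι] (v : ι → K) :
    ∃ N : ℕ, 0 < N ∧ ∀ i, IsIntegral ℤ ((N : K) * v i) := by
  classical
  choose N hN hint using fun i => exists_nat_mul_isIntegral K (v i)
  refine ⟨∏ i, N i, Finset.prod_pos fun i _ => hN i, fun i => ?_⟩
  rw [← Finset.prod_erase_mul _ _ (Finset.mem_univ i), Nat.cast_mul, mul_assoc]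
  exact (isIntegral_natCast _).mul (hint i)

-- (The determinant of a matrix with integral entries is integral: Mathlib's `IsIntegral.det`.)

/-! ### 3. The rank bound -/

/-- `adj(A) (A w) = det A • w`. [folklore] -/
theorem adjugate_mulVec_mulVec {n : Type*} [Fintype n] [DecidableEq n] {A : Type*} [CommRing A]
    (M : Matrix n n A) (w : n → A) : M.adjugate *ᵥ (M *ᵥ w) = M.det • w := by
  rw [mulVec_mulVec, adjugate_mul, smul_mulVec, one_mulVec]

/-- **The rank bound from small independent forms** (Baker Ch. 11 §4, linear version; gives
Rivoal Thm. 5.20 with its constant `[K:ℚ]`). See the module docstring. [folklore] -/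
theorem rank_bound_of_small_forms (K : IntermediateField ℚ ℂ) [FiniteDimensional ℚ K] {ν : ℕ}
    (w : Fin ν → ℂ) (hw : ∃ i, w i ≠ 0)
    (hL4 : ∀ ε : ℝ, 0 < ε → ∃ r₀ : ℕ, ∀ r : ℕ, r₀ ≤ r → ∃ q : Fin ν → Fin ν → K,
      (∀ i j, IsIntegral ℤ (q i j)) ∧ (Matrix.of q).det ≠ 0 ∧
      (∀ i j (σ : K →ₐ[ℚ] ℂ), ‖σ (q i j)‖ ≤ ((r ! : ℕ) : ℝ) ^ (1 + ε)) ∧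
      (∀ j, ‖∑ i, (q i j : ℂ) * w i‖ ≤ ((r ! : ℕ) : ℝ) ^ (-(ν : ℝ) + 1 + ε))) :
    ν ≤ finrank ℚ K * finrank K (Submodule.span K (Set.range w)) := by
  classical
  obtain ⟨i₀, hi₀⟩ := hw
  -- the relations `U = ker (c ↦ ∑ cᵢ wᵢ)` and the rank `ρ`
  set Φ : (Fin ν → K) →ₗ[K] ℂ := Fintype.linearCombination K w with hΦ
  set U : Submodule K (Fin ν → K) := LinearMap.ker Φ with hU
  set ρ := finrank K (Submodule.span K (Set.range w)) with hρ
  set d := finrank ℚ K with hd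
  have hρrange : finrank K (LinearMap.range Φ) = ρ := by
    rw [hρ, hΦ, Fintype.range_linearCombination]
  have hdimU : finrank K U + ρ = ν := by
    have h := LinearMap.finrank_range_add_finrank_ker Φ
    rw [hρrange, finrank_fintype_fun_eq_card, Fintype.card_fin] at h
    rw [hU]; omega
  have hd1 : 1 ≤ d := finrank_pos
  by_contra hcontra
  have hlt : d * ρ < ν := not_le.mp hcontra
  -- an integral basis of `U`
  set nu := finrank K U with hnu
  set bU := Module.finBasis K U
  obtain ⟨Nsc, hNsc, hNint⟩ := exists_nat_mul_isIntegral_family K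
    (fun p : Fin nu × Fin ν => ((bU p.1 : U) : Fin ν → K) p.2)
  set u : Fin nu → (Fin ν → K) := fun k => (Nsc : K) • ((bU k : U) : Fin ν → K) with hu
  have huU : ∀ k, u k ∈ U := fun k => U.smul_mem _ (bU k).2
  have huint : ∀ k i, IsIntegral ℤ (u k i) := fun k i => by
    simp only [hu, Pi.smul_apply, smul_eq_mul]; exact hNint (k, i)
  have hNK : (Nsc : K) ≠ 0 := by exact_mod_cast hNsc.ne'
  have huli : LinearIndependent K u := by
    have h1 : LinearIndependent K (fun k => ((bU k : U) : Fin ν → K)) :=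
      bU.linearIndependent.map' U.subtype (Submodule.ker_subtype U)
    have : u = fun k => (Units.mk0 (Nsc : K) hNK : K) • ((bU k : U) : Fin ν → K) := rfl
    rw [this]
    exact h1.units_smul fun _ => Units.mk0 (Nsc : K) hNK
  -- a uniform bound `Hc ≥ 1` for the conjugates of the entries of `u`
  set Hc : ℝ := 1 + ∑ p : Fin nu × Fin ν × (K →ₐ[ℚ] ℂ), ‖p.2.2 (u p.1 p.2.1)‖ with hHc
  have hsum0 : 0 ≤ ∑ p : Fin nu × Fin ν × (K →ₐ[ℚ] ℂ), ‖p.2.2 (u p.1 p.2.1)‖ :=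
    sum_nonneg fun _ _ => norm_nonneg _
  have hHc1 : 1 ≤ Hc := by linarith
  have hHcσ : ∀ k i (σ : K →ₐ[ℚ] ℂ), ‖σ (u k i)‖ ≤ Hc := by
    intro k i σ
    have h3 : ‖σ (u k i)‖ ≤ ∑ p : Fin nu × Fin ν × (K →ₐ[ℚ] ℂ), ‖p.2.2 (u p.1 p.2.1)‖ :=
      single_le_sum (f := fun p : Fin nu × Fin ν × (K →ₐ[ℚ] ℂ) => ‖p.2.2 (u p.1 p.2.1)‖)
        (fun _ _ => norm_nonneg _) (mem_univ (k, i, σ))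
    linarith
  -- the parameters
  set ε : ℝ := 1 / (2 * (ν : ℝ) + 2) with hε
  have hε0 : 0 < ε := by positivity
  obtain ⟨r₀, hr₀⟩ := hL4 ε hε0
  -- the constant of the final inequality
  set C₁ : ℝ := ν * ((ν ! : ℝ) * Hc ^ nu) ^ d with hC₁
  -- Main estimate: for every `r ≥ r₀`, `‖w i₀‖ (r!)^{1/2} ≤ C₁`.
  have key : ∀ r : ℕ, r₀ ≤ r → ‖w i₀‖ * ((r ! : ℕ) : ℝ) ^ ((1 : ℝ) / 2) ≤ C₁ := by
    intro r hr
    obtain ⟨q, hqint, hqdet, hqσ, hqsmall⟩ := hr₀ r hr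
    set F : ℝ := ((r ! : ℕ) : ℝ) with hF
    have hF1 : (1 : ℝ) ≤ F := by
      rw [hF]; exact_mod_cast Nat.one_le_iff_ne_zero.mpr r.factorial_ne_zero
    have hF0 : 0 < F := lt_of_lt_of_le one_pos hF1
    set G : ℝ := F ^ (1 + ε) with hG
    have hG1 : 1 ≤ G := Real.one_le_rpow hF1 (by linarith)
    set S : ℝ := F ^ (-(ν : ℝ) + 1 + ε) with hS
    -- the rows `q_{·j}` span `K^ν`
    set qrow : Fin ν → (Fin ν → K) := fun j i => q i j with hqrow
    have hqrow_li : LinearIndependent K qrow := by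
      have : qrow = (Matrix.of q).col := by
        funext j i; simp [hqrow, Matrix.col]
      rw [this, Matrix.linearIndependent_cols_iff_isUnit, Matrix.isUnit_iff_isUnit_det]
      exact isUnit_iff_ne_zero.mpr hqdet
    have hqrow_span : Submodule.span K (Set.range qrow) = ⊤ := by
      haveI : Nonempty (Fin ν) := ⟨i₀⟩
      have hc : Fintype.card (Fin ν) = finrank K (Fin ν → K) := by simp
      simpa using (basisOfLinearIndependentOfCardEqFinrank hqrow_li hc).span_eq
    -- complete the integral basis `u` of `U` by `nq = ρ` of the rows
    obtain ⟨nq, J, hcount, hli⟩ :=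
      linearIndependent_sum_elim_of_span_top U u huU huli rfl qrow hqrow_span
    have hnq : nq = ρ := by
      rw [finrank_fintype_fun_eq_card, Fintype.card_fin] at hcount
      omega
    -- the square matrix `R` (rows indexed by `Fin nu ⊕ Fin nq ≃ Fin ν`)
    have hcardT : Fintype.card (Fin nu ⊕ Fin nq) = Fintype.card (Fin ν) := by
      simp only [Fintype.card_sum, Fintype.card_fin]
      rw [finrank_fintype_fun_eq_card, Fintype.card_fin] at hcount
      exact hcount
    set eT : (Fin nu ⊕ Fin nq) ≃ Fin ν := Fintype.equivOfCardEq hcardT with heT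
    set Rrow : (Fin nu ⊕ Fin nq) → (Fin ν → K) := Sum.elim u (qrow ∘ J) with hRrow
    set R : Matrix (Fin ν) (Fin ν) K := Matrix.of fun s i => Rrow (eT.symm s) i with hR
    have hRli : LinearIndependent K R.row := by
      have : R.row = Rrow ∘ eT.symm := by
        funext s i; simp [hR, Matrix.row]
      rw [this]
      exact hli.comp _ eT.symm.injective
    have hRdet : R.det ≠ 0 := by
      have hu : IsUnit R := Matrix.linearIndependent_rows_iff_isUnit.mp hRli
      exact isUnit_iff_ne_zero.mp ((Matrix.isUnit_iff_isUnit_det R).mp hu)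
    have hRint : ∀ s i, IsIntegral ℤ (R s i) := by
      intro s i
      simp only [hR, Matrix.of_apply]
      rcases eT.symm s with k | y
      · exact huint k i
      · exact hqint i (J y)
    -- row bounds for the conjugates: `Hc` on `u`-rows, `G` on `q`-rows
    set y : Fin ν → ℝ := fun s => Sum.elim (fun _ => Hc) (fun _ => G) (eT.symm s) with hy
    have hy1 : ∀ s, 1 ≤ y s := fun s => by
      simp only [hy]; rcases eT.symm s with k | t <;> simp [hHc1, hG1]
    have hyσ : ∀ (σ : K →ₐ[ℚ] ℂ) s i, ‖σ (R s i)‖ ≤ y s := by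
      intro σ s i
      simp only [hR, hy, Matrix.of_apply]
      rcases eT.symm s with k | t
      · exact hHcσ k i σ
      · exact hqσ i (J t) σ
    have hprody : ∏ s, y s = Hc ^ nu * G ^ nq := by
      rw [← eT.prod_comp y]
      simp only [hy, Equiv.symm_apply_apply, Fintype.prod_sum_type, Sum.elim_inl, Sum.elim_inr,
        prod_const, card_univ, Fintype.card_fin]
    -- (a) conjugates of `det R` are `≤ ν! Hc^nu G^nq`, hence Liouville
    have hdetσ : ∀ σ : K →ₐ[ℚ] ℂ, ‖σ R.det‖ ≤ (ν ! : ℝ) * (Hc ^ nu * G ^ nq) := by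
      intro σ
      rw [AlgHom.map_det, ← hprody]
      have := norm_det_le_of_rows ((AlgHom.mapMatrix σ) R) y fun s i => by
        rw [AlgHom.mapMatrix_apply, Matrix.map_apply]; exact hyσ σ s i
      simpa [Fintype.card_fin] using this
    have hLiou := one_le_norm_mul_pow_of_isIntegral K hRdet (IsIntegral.det hRint) hdetσ
    -- (b) the complex matrix `Rc`, `Rc w = v`, and Cramer
    set Rc : Matrix (Fin ν) (Fin ν) ℂ := R.map (algebraMap K ℂ) with hRc
    have hRcdet : Rc.det = ((R.det : K) : ℂ) := by
      rw [hRc, ← RingHom.mapMatrix_apply, ← RingHom.map_det]; rfl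
    set v : Fin ν → ℂ := Rc *ᵥ w with hv
    have hv_u : ∀ s k, eT.symm s = Sum.inl k → v s = 0 := by
      intro s k hs
      have hk : Φ (u k) = 0 := LinearMap.mem_ker.mp (huU k)
      rw [hΦ, Fintype.linearCombination_apply] at hk
      simp only [hv, Matrix.mulVec, dotProduct, hRc, Matrix.map_apply, hR, Matrix.of_apply, hs,
        hRrow, Sum.elim_inl]
      rw [← hk]
      refine Finset.sum_congr rfl fun i _ => ?_
      rw [Algebra.smul_def]
    have hv_q : ∀ s t, eT.symm s = Sum.inr t → ‖v s‖ ≤ S := by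
      intro s t hs
      have : v s = ∑ i, (q i (J t) : ℂ) * w i := by
        simp only [hv, Matrix.mulVec, dotProduct, hRc, Matrix.map_apply, hR, Matrix.of_apply, hs,
          hRrow, Sum.elim_inr, Function.comp_apply, hqrow]
        rfl
      rw [this]; exact hqsmall (J t)
    have hcramer : Rc.det * w i₀ = ∑ s, Rc.adjugate i₀ s * v s := by
      have h := congr_fun (adjugate_mulVec_mulVec Rc w) i₀
      simp only [Pi.smul_apply, smul_eq_mul] at h
      rw [← h]
      simp [Matrix.mulVec, dotProduct, hv]
    -- (c) the adjugate entries against `q`-rows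
    have hadj : ∀ s t, eT.symm s = Sum.inr t →
        ‖Rc.adjugate i₀ s‖ ≤ (ν ! : ℝ) * (Hc ^ nu * G ^ nq / G) := by
      intro s t hs
      have h1 := norm_adjugate_le_of_rows Rc y (fun s' i => by
        rw [hRc, Matrix.map_apply]; exact hyσ (IntermediateField.val K) s' i) i₀ s
      have h2 : ∏ s' ∈ univ.erase s, y s' = Hc ^ nu * G ^ nq / G := by
        have hys : y s = G := by simp [hy, hs]
        have h3 := mul_prod_erase univ y (mem_univ s)
        rw [hprody, hys] at h3
        rw [eq_div_iff (by positivity), mul_comm, h3]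
      rw [h2, Fintype.card_fin] at h1
      exact h1
    -- (d) the upper bound for `‖det Rc‖ ‖w i₀‖`
    have hupper : ‖Rc.det‖ * ‖w i₀‖ ≤ ν * ((ν ! : ℝ) * (Hc ^ nu * G ^ nq / G) * S) := by
      rw [← norm_mul, hcramer]
      calc ‖∑ s, Rc.adjugate i₀ s * v s‖ ≤ ∑ s, ‖Rc.adjugate i₀ s * v s‖ := norm_sum_le _ _
        _ ≤ ∑ _s : Fin ν, (ν ! : ℝ) * (Hc ^ nu * G ^ nq / G) * S := by
            refine sum_le_sum fun s _ => ?_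
            rw [norm_mul]
            rcases hs : eT.symm s with k | t
            · rw [hv_u s k hs, norm_zero, mul_zero]; positivity
            · exact mul_le_mul (hadj s t hs) (hv_q s t hs) (norm_nonneg _) (by positivity)
        _ = ν * ((ν ! : ℝ) * (Hc ^ nu * G ^ nq / G) * S) := by
            rw [sum_const, card_univ, Fintype.card_fin, nsmul_eq_mul]
    -- (e) combine with Liouville: `‖w i₀‖ ≤ C₁ · F^{(1+ε)ρd − ν}`
    have hB0 : 0 < (ν ! : ℝ) * (Hc ^ nu * G ^ nq) := by positivity
    have hw1 : ‖w i₀‖ ≤ ‖w i₀‖ * (‖Rc.det‖ * ((ν ! : ℝ) * (Hc ^ nu * G ^ nq)) ^ (d - 1)) := by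
      have : 1 ≤ ‖Rc.det‖ * ((ν ! : ℝ) * (Hc ^ nu * G ^ nq)) ^ (d - 1) := by
        rw [hRcdet]; exact hLiou
      calc ‖w i₀‖ = ‖w i₀‖ * 1 := (mul_one _).symm
        _ ≤ _ := mul_le_mul_of_nonneg_left this (norm_nonneg _)
    have hw2 : ‖w i₀‖ ≤ ν * ((ν ! : ℝ) * (Hc ^ nu * G ^ nq / G) * S) *
        ((ν ! : ℝ) * (Hc ^ nu * G ^ nq)) ^ (d - 1) := by
      calc ‖w i₀‖ ≤ (‖Rc.det‖ * ‖w i₀‖) * ((ν ! : ℝ) * (Hc ^ nu * G ^ nq)) ^ (d - 1) := by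
            rw [mul_comm ‖Rc.det‖]; rw [mul_assoc]; exact hw1
        _ ≤ _ := mul_le_mul_of_nonneg_right hupper (by positivity)
    -- (f) exponent bookkeeping: the right-hand side is `C₁ · F^{(1+ε)(nq d) − ν}` with
    -- `nq = ρ`, `ρ d ≤ ν − 1`, so it is `≤ C₁ F^{−1/2}`
    have hρd : (nq : ℝ) * d ≤ (ν : ℝ) - 1 := by
      rw [hnq]
      have : ρ * d + 1 ≤ ν := by rw [mul_comm]; omega
      have : ((ρ * d + 1 : ℕ) : ℝ) ≤ ν := by exact_mod_cast this
      push_cast at this; linarith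
    have hexp : (1 + ε) * ((nq : ℝ) * d) - ν ≤ -(1 / 2 : ℝ) := by
      have hεeq : ε * (2 * (ν : ℝ) + 2) = 1 := by
        rw [hε]; field_simp
      have hεν : ε * ((ν : ℝ) - 1) ≤ 1 / 2 := by
        calc ε * ((ν : ℝ) - 1) ≤ ε * ((ν : ℝ) + 1) :=
              mul_le_mul_of_nonneg_left (by linarith) hε0.le
          _ = 1 / 2 := by linarith
      have h1 : (1 + ε) * ((nq : ℝ) * d) ≤ (1 + ε) * ((ν : ℝ) - 1) :=
        mul_le_mul_of_nonneg_left hρd (by linarith)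
      linarith
    have hrhs : ν * ((ν ! : ℝ) * (Hc ^ nu * G ^ nq / G) * S) *
        ((ν ! : ℝ) * (Hc ^ nu * G ^ nq)) ^ (d - 1) =
        C₁ * F ^ ((1 + ε) * ((nq : ℝ) * d) - ν) := by
      -- collect the powers of `F`
      have hd' : ((d - 1 : ℕ) : ℝ) = (d : ℝ) - 1 := by
        rw [Nat.cast_sub hd1, Nat.cast_one]
      have hGpow : G ^ nq = F ^ ((1 + ε) * nq) := by
        rw [hG, ← Real.rpow_natCast, ← Real.rpow_mul hF0.le]
      have hGinv : G⁻¹ = F ^ (-(1 + ε)) := by rw [hG, Real.rpow_neg hF0.le]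
      have hpowd : (F ^ ((1 + ε) * nq)) ^ (d - 1) = F ^ ((1 + ε) * nq * ((d : ℝ) - 1)) := by
        rw [← Real.rpow_natCast, ← Real.rpow_mul hF0.le, hd']
      have hFpart : F ^ ((1 + ε) * nq) * F ^ (-(1 + ε)) * S * F ^ ((1 + ε) * nq * ((d : ℝ) - 1)) =
          F ^ ((1 + ε) * ((nq : ℝ) * d) - ν) := by
        rw [hS, ← Real.rpow_add hF0, ← Real.rpow_add hF0, ← Real.rpow_add hF0]
        congr 1; ring
      have hconst : ((ν ! : ℝ) * Hc ^ nu) * ((ν ! : ℝ) ^ (d - 1) * (Hc ^ nu) ^ (d - 1)) =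
          ((ν ! : ℝ) * Hc ^ nu) ^ d := by
        rw [← mul_pow, ← pow_succ', Nat.sub_add_cancel hd1]
      rw [div_eq_mul_inv, hGinv, hGpow, mul_pow, mul_pow, hpowd, hC₁, ← hconst, ← hFpart]
      ring
    have hw3 : ‖w i₀‖ ≤ C₁ * F ^ (-(1 / 2 : ℝ)) := by
      refine (hw2.trans (le_of_eq hrhs)).trans ?_
      exact mul_le_mul_of_nonneg_left (Real.rpow_le_rpow_of_exponent_le hF1 hexp) (by positivity)
    calc ‖w i₀‖ * F ^ ((1 : ℝ) / 2) ≤ C₁ * F ^ (-(1 / 2 : ℝ)) * F ^ ((1 : ℝ) / 2) :=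
          mul_le_mul_of_nonneg_right hw3 (by positivity)
      _ = C₁ := by
          rw [mul_assoc, ← Real.rpow_add hF0]; norm_num
  -- Conclusion: `F = r!` is unbounded
  have hC₁ : 0 ≤ C₁ := by positivity
  have hwpos : 0 < ‖w i₀‖ := norm_pos_iff.mpr hi₀
  obtain ⟨R₀, hR₀⟩ := exists_nat_gt ((C₁ / ‖w i₀‖) ^ 2)
  set r := max r₀ (R₀ + 1) with hr
  have h1 := key r (le_max_left _ _)
  have h2 : ((R₀ : ℝ) + 1) ≤ ((r ! : ℕ) : ℝ) := by
    have : R₀ + 1 ≤ r ! := (le_max_right _ _).trans (Nat.self_le_factorial r)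
    exact_mod_cast this
  have h3 : (C₁ / ‖w i₀‖) ^ 2 < ((r ! : ℕ) : ℝ) := lt_of_lt_of_le (by linarith) h2
  have h4 : C₁ / ‖w i₀‖ < ((r ! : ℕ) : ℝ) ^ ((1 : ℝ) / 2) := by
    rcases lt_or_ge (C₁ / ‖w i₀‖) 0 with hneg | hnn
    · exact lt_of_lt_of_le hneg (by positivity)
    · have := Real.rpow_lt_rpow (by positivity) h3 (by norm_num : (0 : ℝ) < 1 / 2)
      rwa [← Real.rpow_natCast, ← Real.rpow_mul hnn, show ((2 : ℕ) : ℝ) * (1 / 2) = 1 by norm_num,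
        Real.rpow_one] at this
  have h5 : C₁ < ‖w i₀‖ * ((r ! : ℕ) : ℝ) ^ ((1 : ℝ) / 2) := by
    rwa [div_lt_iff₀ hwpos, mul_comm] at h4
  linarith

end SiegelShidlovskii

end Literature.Barriers.Schanuel

end
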